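import Summits.ResolutionOfSingularities.ResolutionOfSingularities.Theorems.FrobeniusLadderFInjectiveMacaulayficationPencilExitTagTransversal
import Summits.ResolutionOfSingularities.ResolutionOfSingularities.Theorems.FrobeniusLadderFInjectiveMacaulayficationPencilExitTagDeepHalf
import Summits.ResolutionOfSingularities.ResolutionOfSingularities.Theorems.FrobeniusLadderFInjectiveMacaulayficationPencilPhiPrimeU
import Summits.ResolutionOfSingularities.ResolutionOfSingularities.Theorems.FrobeniusLadderFInjectiveMacaulayficationPencilChartTransfer
import HarnessLib

/-!
# TASK 4b SOUNDNESS — THE MASTER THEOREMS: one statement per chart taking the exit tag of ✓p694236 / `exitOK'` as a NINE-WAY DISJUNCTION in `Finsupp` currency and returning `FullCl p`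
# at EVERY closed `k`-point of the chart (`W`-chart: every `w₀`; `U`-chart: the pole by the pole family, `u₀ ≠ 0` by the chart-gluing transfer ✓p701234); primality discharged inside
# (crux `FInjectiveMacaulayfication` stmt-ResolutionOfSingularities-15315, chain w45a; RULINGS R23.8 / R23.12 / desk l.85799 «SOUNDNESS DICTIONARY OF RECORD»; consumer res-L1-w45a-stub-3
# TASK 4c — the list bridge maps `exitOK'` code `t` to the `t`-th disjunct; seat res-L1-w45a-stub-1 g15)

[OURS · L1 W4.5a] Support file (`--supports stmt-ResolutionOfSingularities-15315 --as helper`); theorems only; unconditional; any field of characteristic `p ≥ 5`. Nothing of the crux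
is proved; no census row is asserted. AI-written (AI review is weaker than expert review).

THE DISJUNCTION (`Z = {i : c i = 0}`; `rZ := ∃ i ∈ Z, r i ≠ 0`, `sZ := ∃ i ∈ Z, s i ≠ 0`, `deep := rZ ∧ sZ`, `nonpdiv := rZ ∨ sZ ∨ ∃ i ∉ Z, 1 ≤ |r i − s i| ≤ 4` — verbatim the
clauses of `exitOK`, with codes 5/6 in the strengthened reading of R23.12 (1)):
code 0 `M₁|_Z = 0` · code 1 `¬deep ∧ nonpdiv ∧ M₂|_Z ≤ 1` · code 2 `¬deep ∧ nonpdiv ∧ M₁|_Z ≤ 1` · code 3 `¬deep ∧ nonpdiv ∧ M₁|_Z ≤ 2 ∧ M₂|_Z ≤ 2` · code 4 `deep ∧ M₁|_Z ≤ 1` ·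
code 5 `deep ∧ (M₂+r)|_Z ≤ 1 ∧ ∃ i ∈ Z, M₁ i ≠ 0 = r i` · code 6 (`s`) · code 7 `deep ∧ (M₁+M₂+r)|_Z ≤ 2` · code 8 (`s`). Standing data hypotheses: `M₁ ⊥ M₂`, `r ⊥ s`, `r ≠ s` (true
for the exponent data of every (cone, orbit): `M₁ = C − G`, `M₂ = m − G`, `r = A − m`, `s = B − m`).
* §1 `sub_C_eval_mem_span`, `mem_span_of_eval_eq_zero`, `eval_eq_zero_of_mem_span`, `range_cons_eq` (points ↔ maximal ideals, the elementary direction); §2 ★★★ `fullCl_pencilChartW_of_tag`;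
  §3 ★★★ `fullCl_pencilChartU_pole_of_tag`; §4 `exists_point_W_of_point_U`, ★★★ `fullCl_pencilChartU_of_tag` (every `u₀`).
[cite: Fedder1983, Thm. 1.12]
-/

set_option linter.dupNamespace false

noncomputable section

open AlgebraicGeometry IsLocalRing MvPolynomial
open scoped Pointwise

namespace Summit.ResolutionOfSingularities.ResolutionOfSingularities.Theorems.FInjectiveMacaulayfication.PencilExitTagMaster

open Summit.ResolutionOfSingularities.ResolutionOfSingularities.Theorems.FInjectiveMacaulayfication
open SliceableCentre PencilExitTagW

variable (k : Type) [Field k] {n : ℕ}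

/-! ## §1 Points and their maximal ideals (elementary direction) -/

/-- `f − f(a) ∈ (X_j − a_j : j)`. [folklore] -/
theorem sub_C_eval_mem_span {σ : Type} (a : σ → k) (f : MvPolynomial σ k) :
    f - C (eval a f) ∈ Ideal.span (Set.range fun j : σ => (X j : MvPolynomial σ k) - C (a j)) := by
  induction f using MvPolynomial.induction_on with
  | C b => rw [eval_C, sub_self]; exact Ideal.zero_mem _
  | add p q hp hq =>
    have : p + q - C (eval a (p + q)) = (p - C (eval a p)) + (q - C (eval a q)) := by rw [map_add, map_add]; ring
    rw [this]; exact Ideal.add_mem _ hp hq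
  | mul_X p j hp =>
    have : p * X j - C (eval a (p * X j)) = (p - C (eval a p)) * X j + C (eval a p) * (X j - C (a j)) := by rw [map_mul, eval_X, map_mul]; ring
    rw [this]
    exact Ideal.add_mem _ (Ideal.mul_mem_right _ _ hp) (Ideal.mul_mem_left _ _ (Ideal.subset_span ⟨j, rfl⟩))

/-- `f(a) = 0 ⇒ f ∈ (X_j − a_j : j)`. [folklore] -/
theorem mem_span_of_eval_eq_zero {σ : Type} (a : σ → k) (f : MvPolynomial σ k) (hf : eval a f = 0) :
    f ∈ Ideal.span (Set.range fun j : σ => (X j : MvPolynomial σ k) - C (a j)) := by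
  have := sub_C_eval_mem_span k a f
  rwa [hf, C_0, sub_zero] at this

/-- `f ∈ (X_j − a_j : j) ⇒ f(a) = 0`. [folklore] -/
theorem eval_eq_zero_of_mem_span {σ : Type} (a : σ → k) (f : MvPolynomial σ k) (hf : f ∈ Ideal.span (Set.range fun j : σ => (X j : MvPolynomial σ k) - C (a j))) :
    eval a f = 0 := by
  rw [← RingHom.mem_ker]
  refine (Ideal.span_le.2 ?_) hf
  rintro _ ⟨j, rfl⟩
  rw [SetLike.mem_coe, RingHom.mem_ker, map_sub, eval_X, eval_C, sub_self]

/-- The `Fin.cons` generator family is the point family of `Fin.cons w₀ c`. [plumbing] -/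
theorem range_cons_eq (c : Fin n → k) (w₀ : k) :
    Set.range (Fin.cons ((X 0 : MvPolynomial (Fin (n + 1)) k) - C w₀) fun i : Fin n => X i.succ - C (c i)) =
      Set.range fun j : Fin (n + 1) => (X j : MvPolynomial (Fin (n + 1)) k) - C ((Fin.cons w₀ c : Fin (n + 1) → k) j) := by
  congr 1
  funext j
  refine Fin.cases ?_ (fun i => ?_) j
  · rw [Fin.cons_zero, Fin.cons_zero]
  · rw [Fin.cons_succ, Fin.cons_succ]

/-! ## §2 ★★★ The `W`-chart master theorem -/

/-- ★★★ **`W`-CHART MASTER THEOREM**: for exponent data `M₁ ⊥ M₂`, `r ⊥ s`, `r ≠ s` and `p ≥ 5`, if the (cone, orbit) of the point `(w₀; c)` carries ANY of the nine exit tags (in the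
strengthened reading of codes 5/6), then the `W`-chart `V((y^{M₁})⁺·W − (y^{M₂}(y^r − y^s))⁺)` is `FullCl p` at `(w₀; c)` — every `w₀`. Primality is discharged inside
(✓ `prime_pencilPhiW`). [OURS · TASK 4b soundness dictionary; cite: Fedder1983, Thm. 1.12] -/
theorem fullCl_pencilChartW_of_tag (p : ℕ) [Fact p.Prime] [CharP k p] (hp5 : 5 ≤ p) (M₁ M₂ r s : Fin n →₀ ℕ)
    (hdisj : ∀ i, M₁ i = 0 ∨ M₂ i = 0) (hrs : ∀ i, r i = 0 ∨ s i = 0) (hne : r ≠ s)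
    (Φ : MvPolynomial (Fin (n + 1)) k)
    (hΦ : Φ = rename Fin.succ (monomial M₁ (1 : k)) * X 0 - rename Fin.succ (monomial M₂ (1 : k) * (monomial r 1 - monomial s 1)))
    (c : Fin n → k) (w₀ : k) (y : Spec (.of (MvPolynomial (Fin (n + 1)) k ⧸ Ideal.span {Φ}))) (hy : y.asIdeal.IsMaximal)
    (ha : y.asIdeal.comap (Ideal.Quotient.mk (Ideal.span {Φ})) =
      Ideal.span (Set.range (Fin.cons ((X 0 : MvPolynomial (Fin (n + 1)) k) - C w₀) fun i : Fin n => X i.succ - C (c i))))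
    (htag :
      (∀ i, c i = 0 → M₁ i = 0) ∨
      (¬ ((∃ i, c i = 0 ∧ r i ≠ 0) ∧ (∃ i, c i = 0 ∧ s i ≠ 0)) ∧
        ((∃ i, c i = 0 ∧ r i ≠ 0) ∨ (∃ i, c i = 0 ∧ s i ≠ 0) ∨ (∃ i, c i ≠ 0 ∧ 1 ≤ (r i - s i) + (s i - r i) ∧ (r i - s i) + (s i - r i) ≤ 4)) ∧
        (∀ i, c i = 0 → M₂ i ≤ 1)) ∨
      (¬ ((∃ i, c i = 0 ∧ r i ≠ 0) ∧ (∃ i, c i = 0 ∧ s i ≠ 0)) ∧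
        ((∃ i, c i = 0 ∧ r i ≠ 0) ∨ (∃ i, c i = 0 ∧ s i ≠ 0) ∨ (∃ i, c i ≠ 0 ∧ 1 ≤ (r i - s i) + (s i - r i) ∧ (r i - s i) + (s i - r i) ≤ 4)) ∧
        (∀ i, c i = 0 → M₁ i ≤ 1)) ∨
      (¬ ((∃ i, c i = 0 ∧ r i ≠ 0) ∧ (∃ i, c i = 0 ∧ s i ≠ 0)) ∧
        ((∃ i, c i = 0 ∧ r i ≠ 0) ∨ (∃ i, c i = 0 ∧ s i ≠ 0) ∨ (∃ i, c i ≠ 0 ∧ 1 ≤ (r i - s i) + (s i - r i) ∧ (r i - s i) + (s i - r i) ≤ 4)) ∧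
        (∀ i, c i = 0 → M₁ i ≤ 2) ∧ (∀ i, c i = 0 → M₂ i ≤ 2)) ∨
      (((∃ i, c i = 0 ∧ r i ≠ 0) ∧ (∃ i, c i = 0 ∧ s i ≠ 0)) ∧ (∀ i, c i = 0 → M₁ i ≤ 1)) ∨
      (((∃ i, c i = 0 ∧ r i ≠ 0) ∧ (∃ i, c i = 0 ∧ s i ≠ 0)) ∧ (∀ i, c i = 0 → M₂ i + r i ≤ 1) ∧ (∃ i, c i = 0 ∧ M₁ i ≠ 0 ∧ r i = 0)) ∨
      (((∃ i, c i = 0 ∧ r i ≠ 0) ∧ (∃ i, c i = 0 ∧ s i ≠ 0)) ∧ (∀ i, c i = 0 → M₂ i + s i ≤ 1) ∧ (∃ i, c i = 0 ∧ M₁ i ≠ 0 ∧ s i = 0)) ∨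
      (((∃ i, c i = 0 ∧ r i ≠ 0) ∧ (∃ i, c i = 0 ∧ s i ≠ 0)) ∧ (∀ i, c i = 0 → M₁ i + M₂ i + r i ≤ 2)) ∨
      (((∃ i, c i = 0 ∧ r i ≠ 0) ∧ (∃ i, c i = 0 ∧ s i ≠ 0)) ∧ (∀ i, c i = 0 → M₁ i + M₂ i + s i ≤ 2))) :
    FullCl p ((Spec (.of (MvPolynomial (Fin (n + 1)) k ⧸ Ideal.span {Φ}))).presheaf.stalk y) := by
  have hΦp : Prime Φ := by rw [hΦ]; exact PencilPhiPrime.prime_pencilPhiW k M₁ M₂ r s hdisj hrs hne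
  have hp2 : p ≠ 2 := by omega
  -- from `deep`, a letter of `Z` where `r` and `s` differ
  have hneZ : ((∃ i, c i = 0 ∧ r i ≠ 0) ∧ (∃ i, c i = 0 ∧ s i ≠ 0)) → ∃ i, c i = 0 ∧ r i ≠ s i := by
    rintro ⟨⟨i, hci, hri⟩, -⟩
    exact ⟨i, hci, (hrs i).elim (fun h => absurd h hri) (fun h => by rw [h]; exact hri)⟩
  -- the pencil sub-cases of codes 1 and 3
  have pencil : ∀ (hnd : ¬ ((∃ i, c i = 0 ∧ r i ≠ 0) ∧ (∃ i, c i = 0 ∧ s i ≠ 0)))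
      (hnp : (∃ i, c i = 0 ∧ r i ≠ 0) ∨ (∃ i, c i = 0 ∧ s i ≠ 0) ∨ (∃ i, c i ≠ 0 ∧ 1 ≤ (r i - s i) + (s i - r i) ∧ (r i - s i) + (s i - r i) ≤ 4)),
      ((∀ i, c i = 0 → r i = 0) ↔ ¬ (∀ i, c i = 0 → s i = 0)) ∨
      ((∀ i, c i = 0 → r i = 0) ∧ (∀ i, c i = 0 → s i = 0) ∧ ∃ i₁, c i₁ ≠ 0 ∧ (r i₁ : k) ≠ (s i₁ : k)) := by
    intro hnd hnp
    by_cases hr : ∃ i, c i = 0 ∧ r i ≠ 0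
    · by_cases hs : ∃ i, c i = 0 ∧ s i ≠ 0
      · exact absurd ⟨hr, hs⟩ hnd
      · left
        push Not at hs
        constructor
        · intro h; obtain ⟨i, hci, hri⟩ := hr; exact absurd (h i hci) hri
        · intro h; exact absurd hs h
    · push Not at hr
      by_cases hs : ∃ i, c i = 0 ∧ s i ≠ 0
      · left
        constructor
        · intro _ h; obtain ⟨i, hci, hsi⟩ := hs; exact hsi (h i hci)
        · intro _; exact hr
      · push Not at hs
        right
        refine ⟨hr, hs, ?_⟩
        rcases hnp with ⟨i, hci, hri⟩ | ⟨i, hci, hsi⟩ | ⟨i, hci, hd⟩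
        · exact absurd (hr i hci) hri
        · exact absurd (hs i hci) hsi
        · exact ⟨i, hci, PencilExitTagTransversal.natCast_ne_natCast_of_small k p hp5 (r i) (s i) hd⟩
  rcases htag with h0 | ⟨hnd, hnp, hM₂⟩ | ⟨-, -, hM₁⟩ | ⟨hnd, hnp, hM₁, hM₂⟩ | ⟨-, hM₁⟩ | ⟨hdeep, h5, hiso⟩ | ⟨hdeep, h6, hiso⟩ | ⟨hdeep, h7⟩ | ⟨hdeep, h8⟩
  · -- code 0 ⟹ code 2
    exact fullCl_pencilChartW_of_M₁_le_one k p M₁ _ Φ hΦ hΦp c w₀ y hy ha fun i hci => by rw [h0 i hci]; exact Nat.zero_le _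
  · -- code 1
    rcases pencil hnd hnp with hunit | ⟨hr0, hs0, i₁, hci₁, hne₁⟩
    · exact PencilExitTagCode1.fullCl_pencilChartW_code1 k p M₁ M₂ r s hdisj Φ hΦ hΦp c w₀ y hy ha hM₂ hunit
    · exact PencilExitTagTransversal.fullCl_pencilChartW_code1_twoUnit_all k p M₁ M₂ r s hdisj Φ hΦ hΦp c w₀ y hy ha hM₂ hr0 hs0 i₁ hci₁ hne₁
  · -- code 2
    exact fullCl_pencilChartW_of_M₁_le_one k p M₁ _ Φ hΦ hΦp c w₀ y hy ha hM₁
  · -- code 3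
    have htag' : ∀ i, c i = 0 → M₁ i + M₂ i ≤ 2 := fun i hci => by
      rcases hdisj i with h | h
      · rw [h, zero_add]; exact hM₂ i hci
      · rw [h, add_zero]; exact hM₁ i hci
    rcases pencil hnd hnp with hunit | ⟨hr0, hs0, i₁, hci₁, hne₁⟩
    · exact PencilExitTagCode3.fullCl_pencilChartW_code3 k p hp2 M₁ M₂ r s hdisj Φ hΦ hΦp c w₀ y hy ha htag' hunit
    · by_cases hχ : eval c (monomial r (1 : k) - monomial s 1) = 0
      · exact PencilExitTagTransversal.fullCl_pencilChartW_code3_transversal k p hp2 M₁ M₂ r s hdisj Φ hΦ hΦp c w₀ y hy ha htag' hr0 hs0 hχ i₁ hci₁ hne₁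
      · exact PencilExitTagCode3.fullCl_pencilChartW_code3_twoUnit k p hp2 M₁ M₂ r s hdisj Φ hΦ hΦp c w₀ y hy ha htag' hr0 hs0 hχ
  · -- code 4 ⟹ code 2
    exact fullCl_pencilChartW_of_M₁_le_one k p M₁ _ Φ hΦ hΦp c w₀ y hy ha hM₁
  · -- code 5
    exact PencilExitTagDeep.fullCl_pencilChartW_code5 k p M₁ M₂ r s hdisj Φ hΦ hΦp c w₀ y hy ha h5 (hneZ hdeep) (Or.inr hiso)
  · -- code 6
    exact PencilExitTagDeep.fullCl_pencilChartW_code6 k p M₁ M₂ r s hdisj Φ hΦ hΦp c w₀ y hy ha h6 (hneZ hdeep) (Or.inr hiso)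
  · -- code 7
    exact PencilExitTagDeepHalf.fullCl_pencilChartW_code7 k p hp2 M₁ M₂ r s Φ hΦ hΦp c w₀ y hy ha h7 (hneZ hdeep)
  · -- code 8
    exact PencilExitTagDeepHalf.fullCl_pencilChartW_code8 k p hp2 M₁ M₂ r s Φ hΦ hΦp c w₀ y hy ha h8 (hneZ hdeep)

/-! ## §3 ★★★ The pole master theorem -/

/-- ★★★ **POLE MASTER THEOREM**: under the same data hypotheses and ANY of the nine tags, the `U`-chart `V((y^{M₂}(y^r − y^s))⁺·U − (y^{M₁})⁺)` is `FullCl p` at the pole `(0; c)`.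
Primality discharged inside (✓ `prime_pencilPhiU`). [OURS · TASK 4b soundness dictionary; cite: Fedder1983, Thm. 1.12] -/
theorem fullCl_pencilChartU_pole_of_tag (p : ℕ) [Fact p.Prime] [CharP k p] (hp5 : 5 ≤ p) (M₁ M₂ r s : Fin n →₀ ℕ)
    (hdisj : ∀ i, M₁ i = 0 ∨ M₂ i = 0) (hrs : ∀ i, r i = 0 ∨ s i = 0) (hne : r ≠ s)
    (Φ : MvPolynomial (Fin (n + 1)) k)
    (hΦ : Φ = rename Fin.succ (monomial M₂ (1 : k) * (monomial r 1 - monomial s 1)) * X 0 - rename Fin.succ (monomial M₁ (1 : k)))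
    (c : Fin n → k) (y : Spec (.of (MvPolynomial (Fin (n + 1)) k ⧸ Ideal.span {Φ}))) (hy : y.asIdeal.IsMaximal)
    (ha : y.asIdeal.comap (Ideal.Quotient.mk (Ideal.span {Φ})) =
      Ideal.span (Set.range (Fin.cons (X 0 : MvPolynomial (Fin (n + 1)) k) fun i : Fin n => X i.succ - C (c i))))
    (htag :
      (∀ i, c i = 0 → M₁ i = 0) ∨
      (¬ ((∃ i, c i = 0 ∧ r i ≠ 0) ∧ (∃ i, c i = 0 ∧ s i ≠ 0)) ∧
        ((∃ i, c i = 0 ∧ r i ≠ 0) ∨ (∃ i, c i = 0 ∧ s i ≠ 0) ∨ (∃ i, c i ≠ 0 ∧ 1 ≤ (r i - s i) + (s i - r i) ∧ (r i - s i) + (s i - r i) ≤ 4)) ∧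
        (∀ i, c i = 0 → M₂ i ≤ 1)) ∨
      (¬ ((∃ i, c i = 0 ∧ r i ≠ 0) ∧ (∃ i, c i = 0 ∧ s i ≠ 0)) ∧
        ((∃ i, c i = 0 ∧ r i ≠ 0) ∨ (∃ i, c i = 0 ∧ s i ≠ 0) ∨ (∃ i, c i ≠ 0 ∧ 1 ≤ (r i - s i) + (s i - r i) ∧ (r i - s i) + (s i - r i) ≤ 4)) ∧
        (∀ i, c i = 0 → M₁ i ≤ 1)) ∨
      (¬ ((∃ i, c i = 0 ∧ r i ≠ 0) ∧ (∃ i, c i = 0 ∧ s i ≠ 0)) ∧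
        ((∃ i, c i = 0 ∧ r i ≠ 0) ∨ (∃ i, c i = 0 ∧ s i ≠ 0) ∨ (∃ i, c i ≠ 0 ∧ 1 ≤ (r i - s i) + (s i - r i) ∧ (r i - s i) + (s i - r i) ≤ 4)) ∧
        (∀ i, c i = 0 → M₁ i ≤ 2) ∧ (∀ i, c i = 0 → M₂ i ≤ 2)) ∨
      (((∃ i, c i = 0 ∧ r i ≠ 0) ∧ (∃ i, c i = 0 ∧ s i ≠ 0)) ∧ (∀ i, c i = 0 → M₁ i ≤ 1)) ∨
      (((∃ i, c i = 0 ∧ r i ≠ 0) ∧ (∃ i, c i = 0 ∧ s i ≠ 0)) ∧ (∀ i, c i = 0 → M₂ i + r i ≤ 1) ∧ (∃ i, c i = 0 ∧ M₁ i ≠ 0 ∧ r i = 0)) ∨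
      (((∃ i, c i = 0 ∧ r i ≠ 0) ∧ (∃ i, c i = 0 ∧ s i ≠ 0)) ∧ (∀ i, c i = 0 → M₂ i + s i ≤ 1) ∧ (∃ i, c i = 0 ∧ M₁ i ≠ 0 ∧ s i = 0)) ∨
      (((∃ i, c i = 0 ∧ r i ≠ 0) ∧ (∃ i, c i = 0 ∧ s i ≠ 0)) ∧ (∀ i, c i = 0 → M₁ i + M₂ i + r i ≤ 2)) ∨
      (((∃ i, c i = 0 ∧ r i ≠ 0) ∧ (∃ i, c i = 0 ∧ s i ≠ 0)) ∧ (∀ i, c i = 0 → M₁ i + M₂ i + s i ≤ 2))) :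
    FullCl p ((Spec (.of (MvPolynomial (Fin (n + 1)) k ⧸ Ideal.span {Φ}))).presheaf.stalk y) := by
  have hΦp : Prime Φ := by rw [hΦ]; exact PencilPhiPrimeU.prime_pencilPhiU k M₁ M₂ r s hdisj hrs hne
  have hp2 : p ≠ 2 := by omega
  have hneZ : ((∃ i, c i = 0 ∧ r i ≠ 0) ∧ (∃ i, c i = 0 ∧ s i ≠ 0)) → ∃ i, c i = 0 ∧ r i ≠ s i := by
    rintro ⟨⟨i, hci, hri⟩, -⟩
    exact ⟨i, hci, (hrs i).elim (fun h => absurd h hri) (fun h => by rw [h]; exact hri)⟩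
  have pencil : ∀ (hnd : ¬ ((∃ i, c i = 0 ∧ r i ≠ 0) ∧ (∃ i, c i = 0 ∧ s i ≠ 0)))
      (hnp : (∃ i, c i = 0 ∧ r i ≠ 0) ∨ (∃ i, c i = 0 ∧ s i ≠ 0) ∨ (∃ i, c i ≠ 0 ∧ 1 ≤ (r i - s i) + (s i - r i) ∧ (r i - s i) + (s i - r i) ≤ 4)),
      ((∀ i, c i = 0 → r i = 0) ↔ ¬ (∀ i, c i = 0 → s i = 0)) ∨
      ((∀ i, c i = 0 → r i = 0) ∧ (∀ i, c i = 0 → s i = 0) ∧ ∃ i₁, c i₁ ≠ 0 ∧ (r i₁ : k) ≠ (s i₁ : k)) := by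
    intro hnd hnp
    by_cases hr : ∃ i, c i = 0 ∧ r i ≠ 0
    · by_cases hs : ∃ i, c i = 0 ∧ s i ≠ 0
      · exact absurd ⟨hr, hs⟩ hnd
      · left
        push Not at hs
        constructor
        · intro h; obtain ⟨i, hci, hri⟩ := hr; exact absurd (h i hci) hri
        · intro h; exact absurd hs h
    · push Not at hr
      by_cases hs : ∃ i, c i = 0 ∧ s i ≠ 0
      · left
        constructor
        · intro _ h; obtain ⟨i, hci, hsi⟩ := hs; exact hsi (h i hci)
        · intro _; exact hr
      · push Not at hs
        right
        refine ⟨hr, hs, ?_⟩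
        rcases hnp with ⟨i, hci, hri⟩ | ⟨i, hci, hsi⟩ | ⟨i, hci, hd⟩
        · exact absurd (hr i hci) hri
        · exact absurd (hs i hci) hsi
        · exact ⟨i, hci, PencilExitTagTransversal.natCast_ne_natCast_of_small k p hp5 (r i) (s i) hd⟩
  rcases htag with h0 | ⟨hnd, hnp, hM₂⟩ | ⟨-, -, hM₁⟩ | ⟨hnd, hnp, hM₁, hM₂⟩ | ⟨-, hM₁⟩ | ⟨hdeep, h5, -⟩ | ⟨hdeep, h6, -⟩ | ⟨hdeep, h7⟩ | ⟨hdeep, h8⟩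
  · exact fullCl_pencilChartU_pole_of_M₁_le_one k p M₁ _ Φ hΦ hΦp c y hy ha fun i hci => by rw [h0 i hci]; exact Nat.zero_le _
  · rcases pencil hnd hnp with hunit | ⟨hr0, hs0, i₁, hci₁, hne₁⟩
    · exact PencilExitTagCode1.fullCl_pencilChartU_pole_code1 k p M₁ M₂ r s hdisj Φ hΦ hΦp c y hy ha hM₂ hunit
    · exact PencilExitTagTransversal.fullCl_pencilChartU_pole_code1_twoUnit_all k p M₁ M₂ r s hdisj Φ hΦ hΦp c y hy ha hM₂ hr0 hs0 i₁ hci₁ hne₁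
  · exact fullCl_pencilChartU_pole_of_M₁_le_one k p M₁ _ Φ hΦ hΦp c y hy ha hM₁
  · have htag' : ∀ i, c i = 0 → M₁ i + M₂ i ≤ 2 := fun i hci => by
      rcases hdisj i with h | h
      · rw [h, zero_add]; exact hM₂ i hci
      · rw [h, add_zero]; exact hM₁ i hci
    rcases pencil hnd hnp with hunit | ⟨hr0, hs0, i₁, hci₁, hne₁⟩
    · exact PencilExitTagCode3.fullCl_pencilChartU_pole_code3 k p hp2 M₁ M₂ r s Φ hΦ hΦp c y hy ha htag' hunit
    · by_cases hχ : eval c (monomial r (1 : k) - monomial s 1) = 0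
      · exact PencilExitTagTransversal.fullCl_pencilChartU_pole_code3_transversal k p hp2 M₁ M₂ r s Φ hΦ hΦp c y hy ha htag' hr0 hs0 hχ i₁ hci₁ hne₁
      · exact PencilExitTagCode3.fullCl_pencilChartU_pole_code3_twoUnit k p hp2 M₁ M₂ r s Φ hΦ hΦp c y hy ha htag' hr0 hs0 hχ
  · exact fullCl_pencilChartU_pole_of_M₁_le_one k p M₁ _ Φ hΦ hΦp c y hy ha hM₁
  · exact PencilExitTagDeep.fullCl_pencilChartU_pole_code5 k p M₁ M₂ r s Φ hΦ hΦp c y hy ha h5 (hneZ hdeep)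
  · exact PencilExitTagDeep.fullCl_pencilChartU_pole_code6 k p M₁ M₂ r s Φ hΦ hΦp c y hy ha h6 (hneZ hdeep)
  · exact PencilExitTagDeepHalf.fullCl_pencilChartU_pole_code7 k p hp2 M₁ M₂ r s Φ hΦ hΦp c y hy ha h7 (hneZ hdeep)
  · exact PencilExitTagDeepHalf.fullCl_pencilChartU_pole_code8 k p hp2 M₁ M₂ r s Φ hΦ hΦp c y hy ha h8 (hneZ hdeep)

/-! ## §4 ★★★ Every point of the `U`-chart -/

/-- **THE `W`-CHART POINT UNDER A `U`-CHART POINT WITH `u₀ ≠ 0`**: if `(u₀; c)` is a closed point of `V(Φ_U)`, `Φ_U = B⁺·U − A⁺`, then `(u₀⁻¹; c)` is a closed point of `V(Φ_W)`,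
`Φ_W = A⁺·W − B⁺` (as a point of `Spec` with the expected maximal ideal). [folklore] -/
theorem exists_point_W_of_point_U (A B : MvPolynomial (Fin n) k) (ΦW ΦU : MvPolynomial (Fin (n + 1)) k)
    (hΦW : ΦW = rename Fin.succ A * X 0 - rename Fin.succ B) (hΦU : ΦU = rename Fin.succ B * X 0 - rename Fin.succ A) (c : Fin n → k) (u₀ : k) (hu₀ : u₀ ≠ 0)
    (yU : Spec (.of (MvPolynomial (Fin (n + 1)) k ⧸ Ideal.span {ΦU})))
    (haU : yU.asIdeal.comap (Ideal.Quotient.mk _) = Ideal.span (Set.range (Fin.cons ((X 0 : MvPolynomial (Fin (n + 1)) k) - C u₀) fun i : Fin n => X i.succ - C (c i)))) :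
    ∃ yW : Spec (.of (MvPolynomial (Fin (n + 1)) k ⧸ Ideal.span {ΦW})), yW.asIdeal.IsMaximal ∧
      yW.asIdeal.comap (Ideal.Quotient.mk _) = Ideal.span (Set.range (Fin.cons ((X 0 : MvPolynomial (Fin (n + 1)) k) - C u₀⁻¹) fun i : Fin n => X i.succ - C (c i))) := by
  -- `Φ_U(u₀, c) = 0`, hence `Φ_W(u₀⁻¹, c) = 0`
  have hU0 : eval (Fin.cons u₀ c : Fin (n + 1) → k) ΦU = 0 := by
    refine eval_eq_zero_of_mem_span k _ ΦU ?_
    rw [← range_cons_eq, ← haU, Ideal.mem_comap, Ideal.Quotient.eq_zero_iff_mem.2 (Ideal.mem_span_singleton_self _)]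
    exact Ideal.zero_mem _
  have hevA : ∀ (a₀ : k), eval (Fin.cons a₀ c : Fin (n + 1) → k) (rename Fin.succ A) = eval c A := fun a₀ => by
    rw [eval_rename]; rfl
  have hevB : ∀ (a₀ : k), eval (Fin.cons a₀ c : Fin (n + 1) → k) (rename Fin.succ B) = eval c B := fun a₀ => by
    rw [eval_rename]; rfl
  have hW0 : eval (Fin.cons u₀⁻¹ c : Fin (n + 1) → k) ΦW = 0 := by
    rw [hΦU, map_sub, map_mul, eval_X, Fin.cons_zero, hevA, hevB] at hU0
    rw [hΦW, map_sub, map_mul, eval_X, Fin.cons_zero, hevA, hevB]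
    have : eval c A = eval c B * u₀ := (sub_eq_zero.1 hU0).symm
    rw [this, mul_assoc, mul_inv_cancel₀ hu₀, mul_one, sub_self]
  -- the maximal ideal of the point contains `Φ_W`
  set 𝔪 : Ideal (MvPolynomial (Fin (n + 1)) k) := Ideal.span (Set.range (Fin.cons ((X 0 : MvPolynomial (Fin (n + 1)) k) - C u₀⁻¹) fun i : Fin n => X i.succ - C (c i))) with h𝔪
  have hΦWmem : ΦW ∈ 𝔪 := by rw [h𝔪, range_cons_eq]; exact mem_span_of_eval_eq_zero k _ ΦW hW0
  have hker : Ideal.span {ΦW} ≤ 𝔪 := (Ideal.span_singleton_le_iff_mem _).2 hΦWmem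
  have h𝔪max : 𝔪.IsMaximal := by
    -- `𝔪` is the kernel of evaluation at the point, a maximal ideal
    have hle : 𝔪 ≤ RingHom.ker (eval (Fin.cons u₀⁻¹ c : Fin (n + 1) → k)) := by
      rw [h𝔪, range_cons_eq, Ideal.span_le]; rintro _ ⟨j, rfl⟩
      rw [SetLike.mem_coe, RingHom.mem_ker, map_sub, eval_X, eval_C, sub_self]
    have hge : RingHom.ker (eval (Fin.cons u₀⁻¹ c : Fin (n + 1) → k)) ≤ 𝔪 := fun f hf => by
      rw [h𝔪, range_cons_eq]; exact mem_span_of_eval_eq_zero k _ f hf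
    rw [le_antisymm hle hge]
    exact RingHom.ker_isMaximal_of_surjective _ fun x => ⟨C x, eval_C x⟩
  have hne_top : (𝔪.map (Ideal.Quotient.mk (Ideal.span {ΦW}))) ≠ ⊤ := by
    intro htop
    have := Ideal.comap_map_of_surjective (Ideal.Quotient.mk (Ideal.span {ΦW})) Ideal.Quotient.mk_surjective 𝔪
    rw [htop, Ideal.comap_top] at this
    have h2 : 𝔪 ⊔ Ideal.comap (Ideal.Quotient.mk (Ideal.span {ΦW})) ⊥ = 𝔪 := by
      rw [sup_eq_left, ← RingHom.ker_eq_comap_bot, Ideal.mk_ker]; exact hker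
    rw [h2] at this
    exact h𝔪max.ne_top this.symm
  have hmax' : (𝔪.map (Ideal.Quotient.mk (Ideal.span {ΦW}))).IsMaximal := by
    refine ⟨⟨hne_top, fun J hJ => ?_⟩⟩
    have h1 : 𝔪 < J.comap (Ideal.Quotient.mk (Ideal.span {ΦW})) := by
      refine lt_of_le_of_ne (fun f hf => ?_) (fun heq => ?_)
      · exact Ideal.mem_comap.2 (hJ.le (Ideal.mem_map_of_mem _ hf))
      · apply hJ.ne
        rw [heq, Ideal.map_comap_of_surjective _ Ideal.Quotient.mk_surjective]
    have h2 := h𝔪max.1.2 _ h1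
    rw [Ideal.comap_eq_top_iff] at h2
    exact h2
  refine ⟨⟨𝔪.map (Ideal.Quotient.mk (Ideal.span {ΦW})), hmax'.isPrime⟩, hmax', ?_⟩
  change (𝔪.map (Ideal.Quotient.mk (Ideal.span {ΦW}))).comap _ = _
  rw [Ideal.comap_map_of_surjective _ Ideal.Quotient.mk_surjective, ← RingHom.ker_eq_comap_bot, Ideal.mk_ker, sup_eq_left.2 hker]

/-- ★★★ **`U`-CHART MASTER THEOREM (EVERY `u₀`)**: under the data hypotheses and ANY of the nine tags, the `U`-chart `V((y^{M₂}(y^r − y^s))⁺·U − (y^{M₁})⁺)` is `FullCl p` at every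
closed point `(u₀; c)`: the pole by §3, `u₀ ≠ 0` by the `W`-chart master at `w₀ = u₀⁻¹` and the chart-gluing transfer ✓p701234. [OURS · TASK 4b soundness dictionary;
cite: Fedder1983, Thm. 1.12] -/
theorem fullCl_pencilChartU_of_tag (p : ℕ) [Fact p.Prime] [CharP k p] (hp5 : 5 ≤ p) (M₁ M₂ r s : Fin n →₀ ℕ)
    (hdisj : ∀ i, M₁ i = 0 ∨ M₂ i = 0) (hrs : ∀ i, r i = 0 ∨ s i = 0) (hne : r ≠ s)
    (Φ : MvPolynomial (Fin (n + 1)) k)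
    (hΦ : Φ = rename Fin.succ (monomial M₂ (1 : k) * (monomial r 1 - monomial s 1)) * X 0 - rename Fin.succ (monomial M₁ (1 : k)))
    (c : Fin n → k) (u₀ : k) (y : Spec (.of (MvPolynomial (Fin (n + 1)) k ⧸ Ideal.span {Φ}))) (hy : y.asIdeal.IsMaximal)
    (ha : y.asIdeal.comap (Ideal.Quotient.mk (Ideal.span {Φ})) =
      Ideal.span (Set.range (Fin.cons ((X 0 : MvPolynomial (Fin (n + 1)) k) - C u₀) fun i : Fin n => X i.succ - C (c i))))
    (htag :
      (∀ i, c i = 0 → M₁ i = 0) ∨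
      (¬ ((∃ i, c i = 0 ∧ r i ≠ 0) ∧ (∃ i, c i = 0 ∧ s i ≠ 0)) ∧
        ((∃ i, c i = 0 ∧ r i ≠ 0) ∨ (∃ i, c i = 0 ∧ s i ≠ 0) ∨ (∃ i, c i ≠ 0 ∧ 1 ≤ (r i - s i) + (s i - r i) ∧ (r i - s i) + (s i - r i) ≤ 4)) ∧
        (∀ i, c i = 0 → M₂ i ≤ 1)) ∨
      (¬ ((∃ i, c i = 0 ∧ r i ≠ 0) ∧ (∃ i, c i = 0 ∧ s i ≠ 0)) ∧
        ((∃ i, c i = 0 ∧ r i ≠ 0) ∨ (∃ i, c i = 0 ∧ s i ≠ 0) ∨ (∃ i, c i ≠ 0 ∧ 1 ≤ (r i - s i) + (s i - r i) ∧ (r i - s i) + (s i - r i) ≤ 4)) ∧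
        (∀ i, c i = 0 → M₁ i ≤ 1)) ∨
      (¬ ((∃ i, c i = 0 ∧ r i ≠ 0) ∧ (∃ i, c i = 0 ∧ s i ≠ 0)) ∧
        ((∃ i, c i = 0 ∧ r i ≠ 0) ∨ (∃ i, c i = 0 ∧ s i ≠ 0) ∨ (∃ i, c i ≠ 0 ∧ 1 ≤ (r i - s i) + (s i - r i) ∧ (r i - s i) + (s i - r i) ≤ 4)) ∧
        (∀ i, c i = 0 → M₁ i ≤ 2) ∧ (∀ i, c i = 0 → M₂ i ≤ 2)) ∨
      (((∃ i, c i = 0 ∧ r i ≠ 0) ∧ (∃ i, c i = 0 ∧ s i ≠ 0)) ∧ (∀ i, c i = 0 → M₁ i ≤ 1)) ∨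
      (((∃ i, c i = 0 ∧ r i ≠ 0) ∧ (∃ i, c i = 0 ∧ s i ≠ 0)) ∧ (∀ i, c i = 0 → M₂ i + r i ≤ 1) ∧ (∃ i, c i = 0 ∧ M₁ i ≠ 0 ∧ r i = 0)) ∨
      (((∃ i, c i = 0 ∧ r i ≠ 0) ∧ (∃ i, c i = 0 ∧ s i ≠ 0)) ∧ (∀ i, c i = 0 → M₂ i + s i ≤ 1) ∧ (∃ i, c i = 0 ∧ M₁ i ≠ 0 ∧ s i = 0)) ∨
      (((∃ i, c i = 0 ∧ r i ≠ 0) ∧ (∃ i, c i = 0 ∧ s i ≠ 0)) ∧ (∀ i, c i = 0 → M₁ i + M₂ i + r i ≤ 2)) ∨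
      (((∃ i, c i = 0 ∧ r i ≠ 0) ∧ (∃ i, c i = 0 ∧ s i ≠ 0)) ∧ (∀ i, c i = 0 → M₁ i + M₂ i + s i ≤ 2))) :
    FullCl p ((Spec (.of (MvPolynomial (Fin (n + 1)) k ⧸ Ideal.span {Φ}))).presheaf.stalk y) := by
  by_cases hu₀ : u₀ = 0
  · subst hu₀
    rw [C_0, sub_zero] at ha
    exact fullCl_pencilChartU_pole_of_tag k p hp5 M₁ M₂ r s hdisj hrs hne Φ hΦ c y hy ha htag
  · obtain ⟨yW, hyW, haW⟩ := exists_point_W_of_point_U k (monomial M₁ (1 : k)) (monomial M₂ (1 : k) * (monomial r 1 - monomial s 1)) _ Φ rfl hΦ c u₀ hu₀ y ha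
    have hW := fullCl_pencilChartW_of_tag k p hp5 M₁ M₂ r s hdisj hrs hne _ rfl c u₀⁻¹ yW hyW haW htag
    exact PencilChartTransfer.fullCl_pencilChart_transfer_WU k p (monomial M₁ (1 : k)) (monomial M₂ (1 : k) * (monomial r 1 - monomial s 1)) _ Φ rfl hΦ c u₀ hu₀
      y hy ha yW hyW haW hW

end Summit.ResolutionOfSingularities.ResolutionOfSingularities.Theorems.FInjectiveMacaulayfication.PencilExitTagMaster

end
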